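import Literature.NumberTheory.EllipticCurves.PadicSigmaConstantLimitProofs
import Literature.NumberTheory.EllipticCurves.PadicSigmaVariableChangeProofs
import Literature.NumberTheory.EllipticCurves.PadicSigmaUniquenessOrdinaryProofs
import HarnessLib

/-!
# `E₂(E, ω)_p = 12 · lim_n [x^{pⁿ-2}] f^{(pⁿ-1)/2} / [x^{pⁿ-1}] f^{(pⁿ-1)/2}` for the short model
# `y² = f(x)`: the tree's `padicE2` as an expansion-coefficient limit (proofs only)

Trunk T-NT-EC (Literature/NumberTheory/EllipticCurves). The tree DEFINES the `p`-adic weight-2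
Eisenstein value through the Mazur–Tate constant, `padicE2Local W = a₁² + 4a₂ - 12c` for the
Mazur–Tate sigma pair `(σ, c)` of `W/ℚ_p` (`PadicSigma.lean`; Mazur–Stein–Tate 2006 (1.7):
`c = (a₁² + 4a₂)/12 - E₂(E, ω)/12`), and `padicE2 W p = padicE2Local (W ⊗ ℚ_p)` for `W/ℚ`. This
file makes that value EXPLICIT: transporting the pair to the short model
`y² = f(x) = x³ + a₄'x + a₆'` by Mathlib's `toShortNF` (`u = 1`, `r = -b₂/12`, so `c' = c - b₂/12`,
`PadicSigmaVariableChangeProofs.lean`) and applying the limit formula for the Mazur–Tate constant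
of a model with `a₁ = a₃ = 0` (`IsMazurTateSigmaPair.tendsto_neg_coeff_div_coeff`,
`PadicSigmaConstantLimitProofs.lean`: `c' = -lim_n J_n/H_n`, `H_n = [x^{pⁿ-1}] f^{(pⁿ-1)/2}`,
`J_n = [x^{pⁿ-2}] f^{(pⁿ-1)/2}`, Blakestad–Grant 2023 Thm. 2 with Prop. 3 made explicit) gives

  **`a₁² + 4a₂ - 12c = 12 · lim_n J_n/H_n`**, i.e. `E₂(E, ω) = 12·β` with `β` the constant of the
  `p`-adic Weierstrass zeta function of the short model (`Dζ = -x + β`).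

* `toShortNF_r` (`r = -b₂/12`), `IsMazurTateSigmaPair.toShortNF` (a pair of `W` gives a pair of
  the short model with constant `c - b₂/12`, `p ≥ 5`);
* `IsMazurTateSigmaPair.tendsto_padicE2` — for a `p`-integral `W/ℚ_p`, `p ≥ 5`, unit Hasse
  coefficient `‖w_{p-1}‖ = 1` (good ordinary reduction) and a Mazur–Tate pair `(σ, c)`:
  `12·J_n/H_n → a₁² + 4a₂ - 12c`;
* `tendsto_padicE2Local` — hence `12·J_n/H_n → padicE2Local W` as soon as a Mazur–Tate pair of `W`
  exists (no uniqueness needed); and for a globally minimal `W/ℚ` at a prime `p ≥ 5` of good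
  ordinary reduction, `tendsto_padicE2_of_exists` / `tendsto_padicE2` —
  **`12·J_n/H_n → padicE2 W p`**, the latter from the tree's named fact
  `mazur_tate_sigma_existsUnique` (Mazur–Stein–Tate 2006 Thm. 1.3; only its existence half is used).

So, granted the existence of the Mazur–Tate sigma function, `padicE2` (defined by choice) is Katz's
`E₂(E, ω)` computed by expansion coefficients of powers of `f` (for `37a` at `p = 5`:
`12·lim = 2 + 4·5 + 2·5³ + ⋯`, Mazur–Stein–Tate 2006 §4.1).

## Sources

* B. Mazur, W. Stein, J. Tate, *Computation of `p`-adic heights and log convergence*, Doc. Math.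
  Extra Vol. Coates (2006), Thm. 1.3, (1.5)–(1.7) (`c = (a₁² + 4a₂)/12 - E₂(E,ω)/12`), §3.2
  (computing `E₂(E,ω)`), §4.1 (`37a`, `p = 5`). [MazurSteinTate2006]
* C. Blakestad, D. Grant, J. Number Theory 249 (2023) (arXiv:1903.02480), §2.1 Prop. 3, Thm. 2
  (proof: `β = lim β_n`, `β_n = J_n/H_n`), final Remark of §4 (the congruences "from the point of
  view of `p`-adic modular forms"). [BlakestadGrant2023]
* N. M. Katz, *p-adic properties of modular schemes and modular forms*, LNM 350 (1973), App. 2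
  (`E₂` via the unit-root splitting), as cited in `PadicSigma.lean`.
* J. H. Silverman, *AEC* 2nd ed. (2009), III.1 (changes of variables; `b₂ = a₁² + 4a₂`).

Pure proof file: no definitions, no named facts.
-/

noncomputable section

open PowerSeries Filter Literature.NumberTheory.EllipticCurves
open scoped Topology

namespace WeierstrassCurve

section Local

variable {p : ℕ} [Fact p.Prime] (V : WeierstrassCurve ℚ_[p])

/-- **`toShortNF` has `r = -b₂/12`** (`x = x' - b₂/12` completes the cube after completing the
square). [Silverman AEC III.1] [folklore] -/
theorem toShortNF_r : V.toShortNF.r = -V.b₂ / 12 := by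
  rw [toShortNF, VariableChange.mul_def]
  simp only [toCharNeTwoNF_u, toCharNeTwoNF_r, variableChange_a₂, toCharNeTwoNF_s, Units.val_one,
    inv_one, one_pow, add_zero, b₂, invOf_eq_inv]
  ring

/-- The components of `toShortNF⁻¹` are `p`-integral for `p ≥ 5`. [Silverman AEC III.1] [folklore] -/
theorem norm_toShortNF_inv_le [V.IsIntegral ℤ_[p]] (hp : 5 ≤ p) :
    ‖(V.toShortNF⁻¹.u : ℚ_[p])‖ = 1 ∧ ‖V.toShortNF⁻¹.r‖ ≤ 1 ∧ ‖V.toShortNF⁻¹.s‖ ≤ 1 ∧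
      ‖V.toShortNF⁻¹.t‖ ≤ 1 := by
  obtain ⟨hu, hr, hs, ht⟩ := V.norm_toShortNF_le hp
  have hu1 : V.toShortNF.u = 1 := V.toShortNF_u
  rw [VariableChange.inv_def]
  dsimp only
  rw [hu1, inv_one, Units.val_one, one_pow, one_pow, mul_one, mul_one, mul_one, norm_one, norm_neg,
    norm_neg]
  refine ⟨rfl, hr, hs, ?_⟩
  rw [sub_eq_add_neg]
  refine (Padic.nonarchimedean _ _).trans (max_le ?_ ?_)
  · rw [norm_mul]; exact mul_le_one₀ hr (norm_nonneg _) hs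
  · rw [norm_neg]; exact ht

/-- **A Mazur–Tate sigma pair of `W` yields one of its short model `toShortNF • W`, with constant
`c - b₂/12`** (`p ≥ 5`, `W` `p`-integral): the sigma function is a function on the formal group
and `x = x' + r`, `r = -b₂/12`. [Mazur–Stein–Tate 2006, (1.5)–(1.7) (`℘ = x + (a₁² + 4a₂)/12`);
Silverman AEC III.1] [cite: MazurSteinTate2006, Thm. 1.3] -/
theorem IsMazurTateSigmaPair.toShortNF [V.IsIntegral ℤ_[p]] (hp : 5 ≤ p) {σ : ℚ_[p]⟦X⟧} {c : ℚ_[p]}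
    (h : V.IsMazurTateSigmaPair σ c) :
    ∃ σ' : ℚ_[p]⟦X⟧, (V.toShortNF • V).IsMazurTateSigmaPair σ' (c - V.b₂ / 12) := by
  set V' := V.toShortNF • V with hV'
  haveI : V'.IsIntegral ℤ_[p] := V.isIntegral_toShortNF_smul hp
  obtain ⟨hu, hr, hs, ht⟩ := V.norm_toShortNF_inv_le hp
  have hback : V.toShortNF⁻¹ • V' = V := inv_smul_smul _ _
  have h' : (V.toShortNF⁻¹ • V').IsMazurTateSigmaPair σ c := by rw [hback]; exact h
  have key := IsMazurTateSigmaPair.of_variableChange (V := V') (vc := V.toShortNF⁻¹) hu hr hs ht h'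
  have hc : ((V.toShortNF⁻¹.u : ℚ_[p]ˣ) : ℚ_[p]) ^ 2 * c - V.toShortNF⁻¹.r = c - V.b₂ / 12 := by
    rw [VariableChange.inv_def]
    dsimp only
    rw [V.toShortNF_u, inv_one, Units.val_one, toShortNF_r]
    ring
  rw [hc] at key
  exact ⟨_, key⟩

variable [V.IsIntegral ℤ_[p]]

/-- **`a₁² + 4a₂ - 12c = 12 · lim_n J_n/H_n`** for a Mazur–Tate sigma pair `(σ, c)` of a
`p`-integral `W/ℚ_p` (`p ≥ 5`) with unit Hasse coefficient `‖w_{p-1}‖ = 1` (good ordinary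
reduction), where `H_n = [x^{pⁿ⁺¹-1}] f^m`, `J_n = [x^{pⁿ⁺¹-2}] f^m`, `m = (pⁿ⁺¹-1)/2`, for the short
model `y² = f(x)` (`toShortNF • W`). By Mazur–Stein–Tate (1.7) the left side is `E₂(E, ω)`.
[Mazur–Stein–Tate 2006, Thm. 1.3, (1.7); Blakestad–Grant 2023, Thm. 2 (proof), Prop. 3]
[cite: MazurSteinTate2006, Thm. 1.3] -/
theorem IsMazurTateSigmaPair.tendsto_padicE2 (hp : 5 ≤ p) (hA : ‖coeff (p - 1) V.formalOmega‖ = 1)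
    {σ : ℚ_[p]⟦X⟧} {c : ℚ_[p]} (h : V.IsMazurTateSigmaPair σ c) :
    Tendsto (fun n : ℕ =>
      12 * (((V.toShortNF • V).rhsCubic ^ ((p ^ (n + 1) - 1) / 2)).coeff (p ^ (n + 1) - 2) /
        ((V.toShortNF • V).rhsCubic ^ ((p ^ (n + 1) - 1) / 2)).coeff (p ^ (n + 1) - 1)))
      atTop (𝓝 (V.a₁ ^ 2 + 4 * V.a₂ - 12 * c)) := by
  set V' := V.toShortNF • V with hV'
  haveI : V'.IsIntegral ℤ_[p] := V.isIntegral_toShortNF_smul hp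
  obtain ⟨hu, hr, hs, ht⟩ := V.norm_toShortNF_le hp
  have hA' : ‖coeff (p - 1) V'.formalOmega‖ = 1 :=
    V.norm_coeff_formalOmega_variableChange_eq_one V.toShortNF hu hr hs ht hA
  obtain ⟨σ', h'⟩ := IsMazurTateSigmaPair.toShortNF V hp h
  have hlim := IsMazurTateSigmaPair.tendsto_neg_coeff_div_coeff V' (by omega) h' hA'
  have e : V.a₁ ^ 2 + 4 * V.a₂ - 12 * c = -12 * (c - V.b₂ / 12) := by rw [b₂]; ring
  rw [e]
  have := hlim.const_mul (-12 : ℚ_[p])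
  refine this.congr fun n => ?_
  ring

/-- **`padicE2Local W = 12 · lim_n J_n/H_n`** (short-model coefficients as above) as soon as a
Mazur–Tate sigma pair of `W` exists (`p ≥ 5`, `W` `p`-integral, `‖w_{p-1}‖ = 1`): the tree's
`padicE2Local` (`= a₁² + 4a₂ - 12·padicSigmaConst`, defined by choice) is an expansion-coefficient
limit. [Mazur–Stein–Tate 2006, (1.7); Blakestad–Grant 2023, Thm. 2] [cite: MazurSteinTate2006, §1.1] -/
theorem tendsto_padicE2Local (hp : 5 ≤ p) (hA : ‖coeff (p - 1) V.formalOmega‖ = 1)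
    (hex : ∃ σ : ℚ_[p]⟦X⟧, ∃ c, V.IsMazurTateSigmaPair σ c) :
    Tendsto (fun n : ℕ =>
      12 * (((V.toShortNF • V).rhsCubic ^ ((p ^ (n + 1) - 1) / 2)).coeff (p ^ (n + 1) - 2) /
        ((V.toShortNF • V).rhsCubic ^ ((p ^ (n + 1) - 1) / 2)).coeff (p ^ (n + 1) - 1)))
      atTop (𝓝 V.padicE2Local) := by
  rw [V.padicE2Local_eq hex]
  exact IsMazurTateSigmaPair.tendsto_padicE2 V hp hA (V.isMazurTateSigmaPair_padicSigma hex)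

end Local

section Global

variable (W : WeierstrassCurve ℚ) [W.IsElliptic] [W.IsGloballyMinimal] (p : ℕ) [Fact p.Prime]

omit [W.IsElliptic] in
/-- **`padicE2 W p = 12 · lim_n J_n/H_n` at a prime `p ≥ 5` of good ORDINARY reduction of a
globally minimal `W/ℚ`**, granted the existence of a Mazur–Tate sigma pair of `W ⊗ ℚ_p`; here
`H_n`, `J_n` are the coefficients of `x^{pⁿ⁺¹-1}`, `x^{pⁿ⁺¹-2}` in `f^{(pⁿ⁺¹-1)/2}` for the short
model `y² = f(x)` of `W ⊗ ℚ_p` (Mathlib `toShortNF`). [Mazur–Stein–Tate 2006, Thm. 1.3, (1.7),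
§4.1; Blakestad–Grant 2023, Thm. 2, Prop. 3] [cite: MazurSteinTate2006, §1.1] -/
theorem tendsto_padicE2_of_exists (hp : 5 ≤ p) (hgood : W.HasGoodReductionAtPrime p)
    (hord : ¬ (p : ℤ) ∣ W.frobeniusTrace p)
    (hex : ∃ σ : ℚ_[p]⟦X⟧, ∃ c, (W.baseChange ℚ_[p]).IsMazurTateSigmaPair σ c) :
    Tendsto (fun n : ℕ =>
      12 * ((((W.baseChange ℚ_[p]).toShortNF • W.baseChange ℚ_[p]).rhsCubic ^
          ((p ^ (n + 1) - 1) / 2)).coeff (p ^ (n + 1) - 2) /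
        (((W.baseChange ℚ_[p]).toShortNF • W.baseChange ℚ_[p]).rhsCubic ^
          ((p ^ (n + 1) - 1) / 2)).coeff (p ^ (n + 1) - 1)))
      atTop (𝓝 (W.padicE2 p)) := by
  have hA : ‖coeff (p - 1) (W.baseChange ℚ_[p]).formalOmega‖ = 1 := by
    have h := norm_coeff_formalOmega_eq_one_of_good_ordinary W p (by omega) hgood hord 0
    rwa [zero_add, pow_one] at h
  rw [padicE2_def]
  exact tendsto_padicE2Local (W.baseChange ℚ_[p]) hp hA hex

/-- **`padicE2 W p = 12 · lim_n J_n/H_n`** at a prime `p ≥ 5` of good ordinary reduction of a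
globally minimal `W/ℚ`, from the tree's named fact `mazur_tate_sigma_existsUnique`
(Mazur–Stein–Tate 2006 Thm. 1.3; only the existence half is used). [Mazur–Stein–Tate 2006,
Thm. 1.3, (1.7); Blakestad–Grant 2023, Thm. 2] [cite: MazurSteinTate2006, Thm. 1.3] -/
theorem tendsto_padicE2 (hMT : mazur_tate_sigma_existsUnique) (hp : 5 ≤ p)
    (hgood : W.HasGoodReductionAtPrime p) (hord : ¬ (p : ℤ) ∣ W.frobeniusTrace p) :
    Tendsto (fun n : ℕ =>
      12 * ((((W.baseChange ℚ_[p]).toShortNF • W.baseChange ℚ_[p]).rhsCubic ^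
          ((p ^ (n + 1) - 1) / 2)).coeff (p ^ (n + 1) - 2) /
        (((W.baseChange ℚ_[p]).toShortNF • W.baseChange ℚ_[p]).rhsCubic ^
          ((p ^ (n + 1) - 1) / 2)).coeff (p ^ (n + 1) - 1)))
      atTop (𝓝 (W.padicE2 p)) := by
  obtain ⟨σc, hσc, -⟩ := hMT W p hp hgood hord
  exact tendsto_padicE2_of_exists W p hp hgood hord ⟨σc.1, σc.2, hσc⟩

end Global

end WeierstrassCurve
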